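import Literature.AlgebraicGeometry.Motives.ReducedClosedSubschemeIso
import Literature.AlgebraicGeometry.Morphisms.SubschemeIntegral
import HarnessLib

/-!
# A reduced closed subscheme of an open `U` with support `Z ∩ U` is the piece over `U` of the reduced induced subscheme on `Z`

Topic `Literature/AlgebraicGeometry/Morphisms`. Theorems only; no named fact. Written by the prover seat
`hodge-nonav-19716-p2` (g13, cell `hodge-nonav`) as the route-agnostic half of brick **M1-1 «CHART-IN-COVER»** of
prover-Bx's programme M1 (memo `PROGRAMME-M1-Bx-g19.md` §2; route `HodgeConjecture/Q8SymplecticPowers`, crux K1Q,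
stmt-HodgeConjecture-24190): the explicit étale chart of the normalised quaternionic quartic is a reduced affine scheme,
closed in `D₊(x₂·h̃) ⊆ ℙ³_A`, with support `V₊(Q_e) ∩ D₊(x₂·h̃)` — hence an open piece of the REDUCED cover `cover e`
(`Q8Family.cover`, the reduced induced structure on `V₊(Q_e)`), with no computation of ideals.

For a scheme `Y`, a closed subset `Z ⊆ Y` with reduced induced closed subscheme `ι : Z_red = V(𝓘_Z) ↪ Y`
(Mathlib `IdealSheafData.vanishingIdeal`, `subschemeι`; Hartshorne II Example 3.2.6) and an open `U ⊆ Y`: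

* `isReduced_subscheme_vanishingIdeal` — `Z_red` is reduced (its ideal sheaf is radical);
* `range_subschemeι_morphismRestrict` — the piece `ι ∣_ U : ι⁻¹U → U` has image `Z ∩ U` (as a subset of `U`);
* **`exists_isOpenImmersion_of_isClosedImmersion_of_range_eq`** — UNIQUENESS OF THE REDUCED STRUCTURE, LOCALLY: every
  closed immersion `g : W ↪ U` from a REDUCED scheme with image `Z ∩ U` factors as `W ≅ ι⁻¹U ⊆ Z_red`: there is an open
  immersion `f : W ⟶ Z_red` with `f ≫ ι = g ≫ (U ⊆ Y)` and image `ι⁻¹ U` (both `g` and `ι ∣_ U` are closed immersions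
  from reduced schemes with the same image, so they differ by an isomorphism over `U` — the tree's
  `Motives.exists_iso_of_isClosedImmersion_of_range_eq`, Hartshorne II Example 3.2.6 / Ex. 3.11 (d)).

## References

* [Hartshorne1977] R. Hartshorne, Algebraic Geometry (1977): II Example 3.2.6 (reduced induced structure, uniqueness),
  II Ex. 3.11 (d).
* [GortzWedhorn2020] U. Görtz, T. Wedhorn, Algebraic Geometry I, 2nd ed. (2020), Prop. 3.52 / Remark 3.53 (the reduced
  subscheme structure on a locally closed subset is unique).
-/

noncomputable section

set_option backward.isDefEq.respectTransparency false

open CategoryTheory AlgebraicGeometry TopologicalSpace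

universe u

namespace Literature.AlgebraicGeometry.Morphisms

variable {Y : Scheme.{u}} (Z : Closeds Y)

/-- **`Z_red` is reduced**: the vanishing ideal sheaf of a closed set is radical. [cite: Hartshorne1977, II Example 3.2.6] -/
theorem isReduced_subscheme_vanishingIdeal : IsReduced (Scheme.IdealSheafData.vanishingIdeal Z).subscheme := by
  refine isReduced_subscheme _ (le_antisymm (fun U => ?_) (Scheme.IdealSheafData.le_radical _))
  rw [Scheme.IdealSheafData.radical_ideal, Scheme.IdealSheafData.vanishingIdeal_ideal]
  exact PrimeSpectrum.isRadical_vanishingIdeal _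

/-- **The piece of `Z_red ↪ Y` over an open `U` has image `Z ∩ U`** (read inside `U`). [cite: Hartshorne1977, II Example 3.2.6] -/
theorem range_subschemeι_morphismRestrict (U : Y.Opens) :
    Set.range ((Scheme.IdealSheafData.vanishingIdeal Z).subschemeι ∣_ U) = Subtype.val ⁻¹' (Z : Set Y) := by
  set J := Scheme.IdealSheafData.vanishingIdeal Z with hJ
  have hsupp : Set.range J.subschemeι = (Z : Set Y) := by
    rw [Scheme.IdealSheafData.range_subschemeι, Scheme.IdealSheafData.coe_support_vanishingIdeal]
  ext x
  constructor
  · rintro ⟨w, rfl⟩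
    change ((J.subschemeι ∣_ U) w).1 ∈ (Z : Set Y)
    rw [morphismRestrict_base_coe, ← hsupp]
    exact ⟨w.1, rfl⟩
  · intro hx
    change x.1 ∈ (Z : Set Y) at hx
    rw [← hsupp] at hx
    obtain ⟨y, hy⟩ := hx
    have hyU : y ∈ J.subschemeι ⁻¹ᵁ U := by
      change J.subschemeι y ∈ U
      rw [hy]; exact x.2
    exact ⟨⟨y, hyU⟩, Subtype.ext (by rw [morphismRestrict_base_coe]; exact hy)⟩

/-- **Local uniqueness of the reduced induced structure.** Let `Z ⊆ Y` be closed, `U ⊆ Y` open and `g : W ↪ U` a closed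
immersion from a REDUCED scheme `W` whose image is `Z ∩ U`. Then `W` is the piece of `Z_red` over `U`: there is an open
immersion `f : W ⟶ Z_red` with `f ≫ (Z_red ↪ Y) = g ≫ (U ⊆ Y)` and image `(Z_red ↪ Y)⁻¹ U`.
[cite: Hartshorne1977, II Example 3.2.6] [cite: GortzWedhorn2020, Prop. 3.52] -/
theorem exists_isOpenImmersion_of_isClosedImmersion_of_range_eq (U : Y.Opens) {W : Scheme.{u}} [IsReduced W]
    (g : W ⟶ U) [IsClosedImmersion g] (hrange : Set.range (g ≫ U.ι) = (Z : Set Y) ∩ U) :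
    ∃ (f : W ⟶ (Scheme.IdealSheafData.vanishingIdeal Z).subscheme) (_ : IsOpenImmersion f),
      f ≫ (Scheme.IdealSheafData.vanishingIdeal Z).subschemeι = g ≫ U.ι ∧
      f.opensRange = (Scheme.IdealSheafData.vanishingIdeal Z).subschemeι ⁻¹ᵁ U := by
  set J := Scheme.IdealSheafData.vanishingIdeal Z with hJ
  -- the piece `ι ∣_ U : ι⁻¹ U ↪ U`, a closed immersion from a reduced scheme with image `Z ∩ U`
  haveI : IsClosedImmersion (J.subschemeι ∣_ U) :=
    MorphismProperty.of_isPullback (isPullback_morphismRestrict J.subschemeι U).flip inferInstance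
  haveI : IsReduced J.subscheme := isReduced_subscheme_vanishingIdeal Z
  haveI : IsReduced ↑(J.subschemeι ⁻¹ᵁ U) := isReduced_of_isOpenImmersion (J.subschemeι ⁻¹ᵁ U).ι
  have hg : Set.range g = Subtype.val ⁻¹' (Z : Set Y) := by
    ext x
    constructor
    · rintro ⟨w, rfl⟩
      have hmem : (g ≫ U.ι) w ∈ (Z : Set Y) ∩ U := by rw [← hrange]; exact ⟨w, rfl⟩
      rw [Scheme.Hom.comp_apply, Scheme.Opens.ι_apply] at hmem
      exact hmem.1
    · intro hx
      have hx' : (x.1 : Y) ∈ (Z : Set Y) ∩ U := ⟨hx, x.2⟩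
      rw [← hrange] at hx'
      obtain ⟨w, hw⟩ := hx'
      rw [Scheme.Hom.comp_apply, Scheme.Opens.ι_apply] at hw
      exact ⟨w, Subtype.ext hw⟩
  have hr : Set.range (J.subschemeι ∣_ U) = Set.range g := by
    rw [range_subschemeι_morphismRestrict, hg]
  obtain ⟨e, he⟩ := Motives.exists_iso_of_isClosedImmersion_of_range_eq (J.subschemeι ∣_ U) g hr
  refine ⟨e.hom ≫ (J.subschemeι ⁻¹ᵁ U).ι, inferInstance, ?_, ?_⟩
  · rw [Category.assoc, ← morphismRestrict_ι, ← Category.assoc, he]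
  · rw [Scheme.Hom.opensRange_comp_of_isIso, Scheme.Opens.opensRange_ι]

end Literature.AlgebraicGeometry.Morphisms

end
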